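import Mathlib
import HarnessLib
import Literature.Computability.AlgebraicComplexity.StandardFamiliesProofs
import Summits.ValiantsHypothesis.ValiantsHypothesis.Theses.SummationBits

/-!
# Crux `SummationBits.RyserOptimalDepth3` (stmt-ValiantsHypothesis-7565), line `registered` —
# from the elementary-symmetric model back to affine depth three (Ben-Or interpolation)

Support file (lead prover, `--supports stmt-ValiantsHypothesis-7565`).  The line's normal form
(landed stub N) turns an affine depth-three expression of `per_n` with parameters `(r, D)` into a
representation `per_n = Σ_{i<r} a_i e_n(m_i1, …, m_iD)` by elementary symmetric polynomials of
degree `n` in `D` linear forms, with the same `(r, D)`.  This file proves the converse direction,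
which costs exactly one factor `D + 1` in the number of summands:

* `exists_interp_coeff` — for the `D+1` distinct nodes `0, 1, …, D ∈ ℂ` there are coefficients
  `c_s` with `Σ_s c_s s^k = [k = n]` for all `k ≤ D` (Vandermonde).
* `aeval_esymm_eq_interp` — hence `e_n(m_1, …, m_D) = Σ_{s ≤ D} c_s Π_j (1 + s · m_j)`
  (Ben-Or's interpolation over `D+1` scalings).
* `affine_of_esymRepr` — an e-representation `(r, D)` of `per_n` (`n ≥ 1`) yields an affine
  depth-three expression with parameters `(r·(D+1), D)`.
* `ryserOptimal_imp_esymBound` — consequently the crux `RyserOptimalDepth3` implies the e-model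
  bound with the charge `(D+1)²`: `2^n ≤ r (D+1)² (n+2)^c`.  The line's heart stub
  `stub_esymHighDegree` asserts the same with a single factor `(D+1)`; this theorem pins down
  precisely by how much the heart is stronger than the crux it closes (one factor `D+1`, relevant
  only for e-representations with exponentially large `D`).

References: M. Ben-Or (interpolation trick, as reported in N. Nisan, A. Wigderson, *Lower bounds on
arithmetic circuits via partial derivatives*, Comput. Complexity 6 (1996/97), §1); A. Shpilka,
*Affine projections of symmetric polynomials*, J. Comput. System Sci. 65 (2002), §1.
-/

-- Sub = Summit layout; duplicated namespace component intended
set_option linter.dupNamespace false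

namespace Summit.ValiantsHypothesis.ValiantsHypothesis.Theorems.SummationBitsRyserOptimalDepth3

open MvPolynomial
open Literature.Computability.AlgebraicComplexity

namespace EsymToAffine

/-- **Interpolation coefficients** at the nodes `0, 1, …, D`: there are `c_s ∈ ℂ` with
`Σ_{s ≤ D} c_s · s^k = [k = n]` for every `k ≤ D` (the Vandermonde matrix of distinct nodes is
invertible). [folklore] -/
theorem exists_interp_coeff (D n : ℕ) :
    ∃ c : Fin (D + 1) → ℂ, ∀ k : Fin (D + 1),
      (∑ s : Fin (D + 1), c s * ((s : ℕ) : ℂ) ^ (k : ℕ)) = if (k : ℕ) = n then 1 else 0 := by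
  set V : Matrix (Fin (D + 1)) (Fin (D + 1)) ℂ :=
    Matrix.vandermonde (fun s : Fin (D + 1) => ((s : ℕ) : ℂ)) with hV
  have hdet : IsUnit V.transpose.det := by
    rw [Matrix.det_transpose, isUnit_iff_ne_zero, hV, Matrix.det_vandermonde_ne_zero_iff]
    intro i j h
    simp only at h
    exact Fin.ext (by exact_mod_cast h)
  let b : Fin (D + 1) → ℂ := fun k => if (k : ℕ) = n then 1 else 0
  refine ⟨(V.transpose)⁻¹.mulVec b, fun k => ?_⟩
  have h : V.transpose.mulVec ((V.transpose)⁻¹.mulVec b) = b := by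
    rw [Matrix.mulVec_mulVec, Matrix.mul_nonsing_inv _ hdet, Matrix.one_mulVec]
  have hVapply : ∀ s k : Fin (D + 1), V s k = ((s : ℕ) : ℂ) ^ (k : ℕ) := fun s k => by
    rw [hV, Matrix.vandermonde_apply]
  calc (∑ s : Fin (D + 1), (V.transpose)⁻¹.mulVec b s * ((s : ℕ) : ℂ) ^ (k : ℕ))
        = ∑ s : Fin (D + 1), V.transpose k s * (V.transpose)⁻¹.mulVec b s :=
          Finset.sum_congr rfl fun s _ => by rw [Matrix.transpose_apply, hVapply, mul_comm]
    _ = V.transpose.mulVec ((V.transpose)⁻¹.mulVec b) k := rfl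
    _ = b k := by rw [h]
    _ = if (k : ℕ) = n then 1 else 0 := rfl

/-- **Ben-Or interpolation**: with coefficients as in `exists_interp_coeff`,
`e_n(m_1, …, m_D) = Σ_{s ≤ D} c_s · Π_j (1 + s · m_j)`. [folklore] -/
theorem aeval_esymm_eq_interp {σ : Type*} {D n : ℕ} (c : Fin (D + 1) → ℂ)
    (hc : ∀ k : Fin (D + 1),
      (∑ s : Fin (D + 1), c s * ((s : ℕ) : ℂ) ^ (k : ℕ)) = if (k : ℕ) = n then 1 else 0)
    (m : Fin D → MvPolynomial σ ℂ) :
    (∑ s : Fin (D + 1), C (c s) * ∏ j, (1 + C (((s : ℕ) : ℂ)) * m j)) =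
      aeval m (esymm (Fin D) ℂ n) := by
  classical
  -- expand every product over the subsets `A ⊆ Fin D`
  have hexp : ∀ s : Fin (D + 1), (∏ j, (1 + C (((s : ℕ) : ℂ)) * m j)) =
      ∑ A ∈ (Finset.univ : Finset (Fin D)).powerset,
        C ((((s : ℕ) : ℂ)) ^ A.card) * ∏ j ∈ A, m j := by
    intro s
    rw [Finset.prod_one_add]
    refine Finset.sum_congr rfl fun A _ => ?_
    rw [Finset.prod_mul_distrib, Finset.prod_const, map_pow]
  have hlhs : (∑ s : Fin (D + 1), C (c s) * ∏ j, (1 + C (((s : ℕ) : ℂ)) * m j)) =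
      ∑ A ∈ (Finset.univ : Finset (Fin D)).powerset,
        C (∑ s : Fin (D + 1), c s * (((s : ℕ) : ℂ)) ^ A.card) * ∏ j ∈ A, m j := by
    simp_rw [hexp, Finset.mul_sum, ← mul_assoc, ← map_mul]
    rw [Finset.sum_comm]
    refine Finset.sum_congr rfl fun A _ => ?_
    rw [← Finset.sum_mul, ← map_sum]
  rw [hlhs]
  -- the inner sums are `[#A = n]`
  have hinner : ∀ A ∈ (Finset.univ : Finset (Fin D)).powerset,
      C (∑ s : Fin (D + 1), c s * (((s : ℕ) : ℂ)) ^ A.card) * ∏ j ∈ A, m j =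
        if A.card = n then ∏ j ∈ A, m j else 0 := by
    intro A _
    have hA : A.card < D + 1 := Nat.lt_succ_of_le (by simpa using Finset.card_le_univ A)
    have := hc ⟨A.card, hA⟩
    simp only at this
    rw [this]
    split_ifs <;> simp
  rw [Finset.sum_congr rfl hinner, ← Finset.sum_filter, ← Finset.powersetCard_eq_filter]
  simp only [esymm, map_sum, map_prod, aeval_X]

/-- **From the e-model back to affine depth three.** A representation
`per_n = Σ_{i<r} a_i · e_n(m_i1, …, m_iD)` by linear forms (`n ≥ 1`) yields an affine depth-three
expression `per_n = Σ_{i' < r(D+1)} Π_{j<D} ℓ_{i'j}` — summand `(i, s)` is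
`a_i c_s · Π_j (1 + s · m_ij)` with the scalar folded into the first factor. [folklore] -/
theorem affine_of_esymRepr {n r D : ℕ} (hn : 1 ≤ n) (a : Fin r → ℂ)
    (m : Fin r → Fin D → MvPolynomial (Fin n × Fin n) ℂ) (hm : ∀ i j, (m i j).IsHomogeneous 1)
    (hsum : (∑ i, C (a i) * aeval (m i) (esymm (Fin D) ℂ n)) = perPoly (Fin n) ℂ) :
    ∃ ℓ : Fin (r * (D + 1)) → Fin D → MvPolynomial (Fin n × Fin n) ℂ,
      (∀ i j, (ℓ i j).totalDegree ≤ 1) ∧ (∑ i, ∏ j, ℓ i j) = perPoly (Fin n) ℂ := by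
  classical
  cases D with
  | zero =>
    -- no factors: `e_n` of the empty family vanishes for `n ≥ 1`, contradicting `per_n ≠ 0`
    exfalso
    refine perPoly_ne_zero (Fin n) ℂ ?_
    rw [← hsum]
    refine Finset.sum_eq_zero fun i _ => ?_
    have h0 : esymm (Fin 0) ℂ n = 0 := by
      rw [esymm, Finset.powersetCard_eq_empty.2 (by simp; omega), Finset.sum_empty]
    rw [h0, map_zero, mul_zero]
  | succ D =>
    obtain ⟨c, hc⟩ := exists_interp_coeff (D + 1) n
    -- summand `(i, s)`, factor `j`
    let L : Fin r × Fin (D + 1 + 1) → Fin (D + 1) → MvPolynomial (Fin n × Fin n) ℂ :=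
      fun p j => (if j = 0 then C (a p.1 * c p.2) else 1) * (1 + C (((p.2 : ℕ) : ℂ)) * m p.1 j)
    refine ⟨fun i' j => L (finProdFinEquiv.symm i') j, fun i' j => ?_, ?_⟩
    · -- affine factors
      show (L (finProdFinEquiv.symm i') j).totalDegree ≤ 1
      generalize finProdFinEquiv.symm i' = p
      show ((if j = 0 then C (a p.1 * c p.2) else 1) *
        (1 + C (((p.2 : ℕ) : ℂ)) * m p.1 j)).totalDegree ≤ 1
      refine (totalDegree_mul _ _).trans ?_
      have h1 : (if j = 0 then C (a p.1 * c p.2)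
          else (1 : MvPolynomial (Fin n × Fin n) ℂ)).totalDegree = 0 := by
        split_ifs
        · exact totalDegree_C _
        · exact totalDegree_one
      have h2 : (1 + C (((p.2 : ℕ) : ℂ)) * m p.1 j).totalDegree ≤ 1 := by
        refine (totalDegree_add _ _).trans (max_le (by simp) ?_)
        refine (totalDegree_mul _ _).trans ?_
        rw [totalDegree_C, zero_add]
        exact (hm _ _).totalDegree_le
      omega
    · -- the sum: reindex over pairs `(i, s)`, pull out the scalars, interpolate
      have hre : (∑ i' : Fin (r * (D + 1 + 1)), ∏ j, L (finProdFinEquiv.symm i') j) =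
          ∑ p : Fin r × Fin (D + 1 + 1), ∏ j, L p j :=
        Fintype.sum_equiv finProdFinEquiv.symm _ _ fun _ => rfl
      rw [hre, Fintype.sum_prod_type, ← hsum]
      refine Finset.sum_congr rfl fun i _ => ?_
      have hprod : ∀ s : Fin (D + 1 + 1), (∏ j, L (i, s) j) =
          C (a i * c s) * ∏ j, (1 + C (((s : ℕ) : ℂ)) * m i j) := by
        intro s
        simp only [L]
        rw [Finset.prod_mul_distrib, Finset.prod_ite_eq']
        simp
      simp_rw [hprod, map_mul, mul_assoc, ← Finset.mul_sum]
      rw [aeval_esymm_eq_interp c hc (m i)]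

end EsymToAffine

/-- **Registered sub-goal `stub_esymToAffine` of crux stmt-ValiantsHypothesis-7565** (lead, line
`registered`): an e-representation of `per_n` with parameters `(r, D)` gives an affine depth-three
expression with parameters `(r·(D+1), D)` — `EsymToAffine.affine_of_esymRepr` under its registered
name (Ben-Or interpolation). [folklore] -/
theorem stub_esymToAffine :
    ∀ n r D : ℕ, 1 ≤ n →
      ∀ (a : Fin r → ℂ) (m : Fin r → Fin D → MvPolynomial (Fin n × Fin n) ℂ),
        (∀ i j, (m i j).IsHomogeneous 1) →
          (∑ i, C (a i) * aeval (m i) (esymm (Fin D) ℂ n)) = perPoly (Fin n) ℂ →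
            ∃ ℓ : Fin (r * (D + 1)) → Fin D → MvPolynomial (Fin n × Fin n) ℂ,
              (∀ i j, (ℓ i j).totalDegree ≤ 1) ∧ (∑ i, ∏ j, ℓ i j) = perPoly (Fin n) ℂ :=
  fun _n _r _D hn a m hm hsum => EsymToAffine.affine_of_esymRepr hn a m hm hsum

/-- **The crux implies the e-model bound with charge `(D+1)²`.** If Ryser is optimal at depth
three up to `poly(n)` (`SummationBits.RyserOptimalDepth3`), then every representation
`per_n = Σ_{i<r} a_i · e_n(m_i1, …, m_iD)` by linear forms has `2^n ≤ r (D+1)² (n+2)^c` — one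
factor `D+1` weaker than the line's heart stub `stub_esymHighDegree`, by Ben-Or interpolation
(`EsymToAffine.affine_of_esymRepr`). [folklore] -/
theorem ryserOptimal_imp_esymBound
    (h : Summit.ValiantsHypothesis.ValiantsHypothesis.Theses.SummationBits.RyserOptimalDepth3) :
    ∃ c : ℕ, ∀ n : ℕ, 1 ≤ n →
      ∀ (r D : ℕ) (a : Fin r → ℂ) (m : Fin r → Fin D → MvPolynomial (Fin n × Fin n) ℂ),
        (∀ i j, (m i j).IsHomogeneous 1) →
          (∑ i, C (a i) * aeval (m i) (esymm (Fin D) ℂ n)) = perPoly (Fin n) ℂ →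
            2 ^ n ≤ r * (D + 1) * (D + 1) * (n + 2) ^ c := by
  obtain ⟨c, hc⟩ := h
  refine ⟨c, fun n hn r D a m hm hsum => ?_⟩
  obtain ⟨ℓ, hℓ, hsum'⟩ := EsymToAffine.affine_of_esymRepr hn a m hm hsum
  exact hc n hn (r * (D + 1)) D ℓ hℓ hsum'

end Summit.ValiantsHypothesis.ValiantsHypothesis.Theorems.SummationBitsRyserOptimalDepth3
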